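import Summits.KontsevichZagierPeriods.Zeta5Search.Barrier.ConeGammaCuspSlopeTangentCone

/-!
# ζ(5) search — BARRIER: THE TANGENT CONE OF THE CUSP SLOPE — modular tied classes, adjacent references, and the
# EXTREMUM CRITERION (file (2) of «THE UNIFORM TANGENT CONE»)

HONEST FRAMING (cell `pub-zeta5`): systematic search; no irrationality claim unless kernel-certified. MODEL objects
under Brown–Zudilin's (28)+(30) accounting ([BZ22] = arXiv:2210.03391; (28) observed, not proved); nothing here is a
statement about `ζ(5)`, any `γ` of record, the cone's supremum (C2 OPEN) or the value / sign of the cusp slope, of a chamber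
weight, of a wall defect or of a one-sided derivative at a named direction (DATA of the cell); NO cancellation is quantified;
S-E / (TD_A) stay CONJECTURED; records in print UNMOVED. Prover P2 g43 (item «THE UNIFORM TANGENT CONE», file (2); plan
INBOX 2026-08-28). Sources: file (1) `ConeGammaCuspSlopeTangentCone` (the tangent cone is attained on a neighbourhood; the
differentiability criterion in reference form), P2 g30 `ConeGammaCuspGermKink` (`greedy_sub_greedy_of_adjacent`) and
`ConeGammaCuspChamberCover` (`exists_rate_sub_ne_zero`, `exists_generic_refines`), P2 g42 `ConeGammaCuspSlopeLexGerm`.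

SETTING as in file (1): `σ = cuspSlope a T`, rates `r_k = φ_k/h_k(a)`, `F` the canonical period pattern function, `W_k(δ₀)` the
canonical chamber weights. At a displacement `δ` write `U_k = {l : r_k(δ) < r_l(δ)}` (forms strictly above `k`) and
`C_k = {l : r_l(δ) = r_k(δ)}` (the tied class of `k`).
* **`greedy_weight_eq_of_modular_classes`** — if the localised pattern function `B ↦ F(U_k ∪ B)` is MODULAR on every tied class
  (`F(U_k ∪ B) = F(U_k) + Σ_{j∈B} (F(U_k ∪ {j}) − F(U_k))` for `B ⊆ C_k`), then EVERY generic reference refining `δ` has the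
  reference-free weights `W_k(δ₀) = F(U_k ∪ {k}) − F(U_k)`; hence **`differentiableAt_cuspSlope_of_modular_classes`: `σ` is
  differentiable at `δ` with `fderiv σ δ Δ = Σ_k (F(U_k ∪ {k}) − F(U_k))·r_k(Δ)`** (a generic `δ`: the hypothesis is vacuous and
  these are P2 g33's weights; a simple tie: the hypothesis is `m_F = 0`, P2 g42's sufficiency);
* **`defect_eq_zero_of_differentiableAt`** — conversely, if `σ` is differentiable at `δ` and two generic references refining
  `δ` are ONE ADJACENT TRANSPOSITION `(k, l)` apart, then the pooled wall defect `F(S+k) + F(S+l) − F(S) − F(S+k+l)` behind their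
  common prefix `S` VANISHES (file (1): both functionals are `fderiv σ δ`; g30: they differ by the defect times `r_l − r_k ≢ 0`).
  Which adjacent pairs of orders are REALISED by references near a named `δ` is DATA — the honest gap between the two;
* **`isLocalMax_cuspSlope_iff` / `isLocalMin_cuspSlope_iff` — THE EXTREMUM CRITERION**: `δ` is a local maximiser (minimiser)
  of `σ` iff EVERY one-sided directional derivative at `δ` is `≤ 0` (`≥ 0`), i.e. iff every lexicographic chamber functional of
  `(δ, Δ)` is `≤ 0` (`≥ 0`) at `Δ` — true for `σ` because its tangent cone is attained on a neighbourhood (file (1)), false for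
  general functions; `refines_lex_iff_cone` — the directions served by a reference form the closed polyhedral LOCAL CONE of
  the reference at `δ`, so the criterion is FINITE (one cone and one functional per realised order);
  `cuspSlope_eventually_const_of_isLocalExtr` — a local extremum at a differentiability point is FLAT (so
  every strict local extremum of `σ` is a non-differentiability point); **`isLocalMax_cuspSlope_zero_iff`** — at the origin:
  `0` is a local maximiser of `σ` iff `σ ≤ 0` everywhere (the cell's «no ascent direction», by conic structure).
NOT here (honest): any value of `F`, `W_k`, `m_F` or of a derivative at a named direction, which orders are realised (DATA);
the exact kink at a multiple tie as a signed sum; `Φ`, `γ`, C2, S-E's truth, `ζ(5)`.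
-/

noncomputable section

open Set Finset Filter
open scoped Topology

namespace Summit.KontsevichZagierPeriods.Zeta5Search.Barrier.ConeGamma

/-! ### Modular tied classes: reference-free weights and differentiability -/

/-- **MODULAR TIED CLASSES GIVE REFERENCE-FREE WEIGHTS.** Let `δ₀` be a generic reference refining `δ`, and suppose the
localised pattern function is modular on every tied class of `δ`: for every `k` and every `B ⊆ C_k = {l : r_l(δ) = r_k(δ)}`,
`F(U_k ∪ B) = F(U_k) + Σ_{j∈B} (F(U_k ∪ {j}) − F(U_k))`, `U_k = {l : r_k(δ) < r_l(δ)}`. Then for every `k`: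
`W_k(δ₀) = F(U_k ∪ {k}) − F(U_k)` (the prefix of `k` in `δ₀` is `U_k` plus the class members above `k`). -/
theorem greedy_weight_eq_of_modular_classes {a : Dir} {F : Finset (Fin 28) → ℝ} {δ δ₀ : Fin 8 → ℝ}
    (hgen : ∀ k l : Fin 28, k ≠ l → phiForm δ₀ k / h28 a k ≠ phiForm δ₀ l / h28 a l)
    (href : ∀ k l : Fin 28, phiForm δ k / h28 a k < phiForm δ l / h28 a l →
      phiForm δ₀ k / h28 a k < phiForm δ₀ l / h28 a l)
    (hmod : ∀ k : Fin 28, ∀ B : Finset (Fin 28),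
      B ⊆ Finset.univ.filter (fun l => phiForm δ l / h28 a l = phiForm δ k / h28 a k) →
        F (Finset.univ.filter (fun l => phiForm δ k / h28 a k < phiForm δ l / h28 a l) ∪ B) =
          F (Finset.univ.filter fun l => phiForm δ k / h28 a k < phiForm δ l / h28 a l) +
            ∑ j ∈ B, (F (insert j (Finset.univ.filter fun l => phiForm δ k / h28 a k < phiForm δ l / h28 a l)) -
              F (Finset.univ.filter fun l => phiForm δ k / h28 a k < phiForm δ l / h28 a l)))
    (k : Fin 28) :
    F (Finset.univ.filter fun l => phiForm δ₀ k / h28 a k ≤ phiForm δ₀ l / h28 a l) -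
        F (Finset.univ.filter fun l => phiForm δ₀ k / h28 a k < phiForm δ₀ l / h28 a l) =
      F (insert k (Finset.univ.filter fun l => phiForm δ k / h28 a k < phiForm δ l / h28 a l)) -
        F (Finset.univ.filter fun l => phiForm δ k / h28 a k < phiForm δ l / h28 a l) := by
  classical
  set U := Finset.univ.filter (fun l => phiForm δ k / h28 a k < phiForm δ l / h28 a l) with hU
  set B := Finset.univ.filter (fun l => phiForm δ l / h28 a l = phiForm δ k / h28 a k ∧
    phiForm δ₀ k / h28 a k < phiForm δ₀ l / h28 a l) with hB
  -- the strict prefix of `k` in `δ₀` is `U ∪ B`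
  have hlt : Finset.univ.filter (fun l => phiForm δ₀ k / h28 a k < phiForm δ₀ l / h28 a l) = U ∪ B := by
    ext l
    simp only [hU, hB, Finset.mem_filter, Finset.mem_union, Finset.mem_univ, true_and]
    constructor
    · intro h
      rcases lt_trichotomy (phiForm δ k / h28 a k) (phiForm δ l / h28 a l) with h1 | h1 | h1
      · exact Or.inl h1
      · exact Or.inr ⟨h1.symm, h⟩
      · exact absurd ((href l k h1).trans h) (lt_irrefl _)
    · rintro (h | ⟨_, h⟩)
      · exact href k l h
      · exact h
  -- the weak prefix is the strict one plus `k`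
  have hle : Finset.univ.filter (fun l => phiForm δ₀ k / h28 a k ≤ phiForm δ₀ l / h28 a l) = U ∪ insert k B := by
    rw [Finset.union_insert, ← hlt]
    ext l
    simp only [Finset.mem_filter, Finset.mem_insert, Finset.mem_univ, true_and]
    constructor
    · intro h
      rcases h.lt_or_eq with h1 | h1
      · exact Or.inr h1
      · by_cases hlk : l = k
        · exact Or.inl hlk
        · exact absurd h1 (hgen k l (Ne.symm hlk))
    · rintro (rfl | h)
      · exact le_rfl
      · exact h.le
  have hBsub : B ⊆ Finset.univ.filter (fun l => phiForm δ l / h28 a l = phiForm δ k / h28 a k) := by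
    intro l hl
    rw [hB, Finset.mem_filter] at hl
    exact Finset.mem_filter.mpr ⟨Finset.mem_univ _, hl.2.1⟩
  have hkBsub : insert k B ⊆ Finset.univ.filter (fun l => phiForm δ l / h28 a l = phiForm δ k / h28 a k) := by
    intro l hl
    rcases Finset.mem_insert.mp hl with rfl | hl
    · exact Finset.mem_filter.mpr ⟨Finset.mem_univ _, rfl⟩
    · exact hBsub hl
  have hkB : k ∉ B := by
    rw [hB, Finset.mem_filter]
    exact fun h => lt_irrefl _ h.2.2
  rw [hle, hlt, hmod k (insert k B) hkBsub, hmod k B hBsub, Finset.sum_insert hkB]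
  ring

/-- **The chamber functional of every refining reference is the reference-free one** under modular tied classes. -/
theorem greedy_eq_free_of_modular_classes {a : Dir} {F : Finset (Fin 28) → ℝ} {δ δ₀ : Fin 8 → ℝ}
    (hgen : ∀ k l : Fin 28, k ≠ l → phiForm δ₀ k / h28 a k ≠ phiForm δ₀ l / h28 a l)
    (href : ∀ k l : Fin 28, phiForm δ k / h28 a k < phiForm δ l / h28 a l →
      phiForm δ₀ k / h28 a k < phiForm δ₀ l / h28 a l)
    (hmod : ∀ k : Fin 28, ∀ B : Finset (Fin 28),
      B ⊆ Finset.univ.filter (fun l => phiForm δ l / h28 a l = phiForm δ k / h28 a k) →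
        F (Finset.univ.filter (fun l => phiForm δ k / h28 a k < phiForm δ l / h28 a l) ∪ B) =
          F (Finset.univ.filter fun l => phiForm δ k / h28 a k < phiForm δ l / h28 a l) +
            ∑ j ∈ B, (F (insert j (Finset.univ.filter fun l => phiForm δ k / h28 a k < phiForm δ l / h28 a l)) -
              F (Finset.univ.filter fun l => phiForm δ k / h28 a k < phiForm δ l / h28 a l)))
    (Δ : Fin 8 → ℝ) :
    ∑ k, (F (Finset.univ.filter fun l => phiForm δ₀ k / h28 a k ≤ phiForm δ₀ l / h28 a l) -
          F (Finset.univ.filter fun l => phiForm δ₀ k / h28 a k < phiForm δ₀ l / h28 a l)) *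
        (phiForm Δ k / h28 a k) =
      ∑ k, (F (insert k (Finset.univ.filter fun l => phiForm δ k / h28 a k < phiForm δ l / h28 a l)) -
          F (Finset.univ.filter fun l => phiForm δ k / h28 a k < phiForm δ l / h28 a l)) *
        (phiForm Δ k / h28 a k) :=
  Finset.sum_congr rfl fun k _ => by rw [greedy_weight_eq_of_modular_classes hgen href hmod k]

/-- **MODULAR TIED CLASSES ⇒ `σ` IS DIFFERENTIABLE, WITH THE REFERENCE-FREE GRADIENT.** All 28 forms of `a` positive, `T > 0`
a period, `F` the canonical period pattern function; `δ` a displacement at which the localised pattern function is modular on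
every tied class (hypothesis `hmod`; vacuous at a generic `δ`, `m_F = 0` at a simple tie). Then `σ` is differentiable at `δ` and
**`fderiv σ δ Δ = Σ_k (F(U_k ∪ {k}) − F(U_k))·φ_k(Δ)/h_k(a)`**, `U_k = {l : r_k(δ) < r_l(δ)}`. -/
theorem differentiableAt_cuspSlope_of_modular_classes {a : Dir} (hpos : ∀ k, 0 < h28 a k) {T : ℝ} (hT : 0 < T)
    (hper : ∀ k : Fin 28, ∃ z : ℤ, T * h28 a k = z) {F : Finset (Fin 28) → ℝ}
    (hF : ∀ A, F A = ∑ m ∈ Finset.range ((bkpts a T).card - 1), ((patternN a (bkpt a T m) A : ℤ) : ℝ))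
    {δ : Fin 8 → ℝ}
    (hmod : ∀ k : Fin 28, ∀ B : Finset (Fin 28),
      B ⊆ Finset.univ.filter (fun l => phiForm δ l / h28 a l = phiForm δ k / h28 a k) →
        F (Finset.univ.filter (fun l => phiForm δ k / h28 a k < phiForm δ l / h28 a l) ∪ B) =
          F (Finset.univ.filter fun l => phiForm δ k / h28 a k < phiForm δ l / h28 a l) +
            ∑ j ∈ B, (F (insert j (Finset.univ.filter fun l => phiForm δ k / h28 a k < phiForm δ l / h28 a l)) -
              F (Finset.univ.filter fun l => phiForm δ k / h28 a k < phiForm δ l / h28 a l))) :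
    DifferentiableAt ℝ (cuspSlope a T) δ ∧ ∀ Δ : Fin 8 → ℝ, fderiv ℝ (cuspSlope a T) δ Δ =
      ∑ k, (F (insert k (Finset.univ.filter fun l => phiForm δ k / h28 a k < phiForm δ l / h28 a l)) -
          F (Finset.univ.filter fun l => phiForm δ k / h28 a k < phiForm δ l / h28 a l)) *
        (phiForm Δ k / h28 a k) := by
  obtain ⟨δ₁, hgen₁, href₁⟩ := exists_generic_refines hpos δ
  have h := differentiableAt_cuspSlope_of_greedy_eq hpos hT hper hF (δ₁ := δ₁) fun δ₀ hgen₀ href₀ Δ => by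
    rw [greedy_eq_free_of_modular_classes hgen₀ href₀ hmod, greedy_eq_free_of_modular_classes hgen₁ href₁ hmod]
  exact ⟨h.1, fun Δ => by rw [h.2 Δ, greedy_eq_free_of_modular_classes hgen₁ href₁ hmod]⟩

/-! ### Adjacent references at a differentiability point: the pooled defect vanishes -/

/-- **WHERE `σ` IS DIFFERENTIABLE, TWO REFINING REFERENCES ONE ADJACENT TRANSPOSITION APART HAVE ZERO POOLED DEFECT.** All 28
forms of `a` positive, `T > 0` a period, `F` the canonical period pattern function; `σ` differentiable at `δ`; `δ₀`, `δ₀'` generic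
references refining `δ`, whose rate orders differ exactly by the transposition of `k ≠ l` — `r_l(δ₀) < r_k(δ₀)` with no form
strictly between, `r_k(δ₀') < r_l(δ₀')`, every other form on the same side of the pair and in the same relative order for both.
Then, with `S = {j : r_k(δ₀) < r_j(δ₀)}` the common prefix, **`F(S∪{k}) + F(S∪{l}) − F(S) − F(S∪{k,l}) = 0`**. -/
theorem defect_eq_zero_of_differentiableAt {a : Dir} (hpos : ∀ k, 0 < h28 a k) {T : ℝ} (hT : 0 < T)
    (hper : ∀ k : Fin 28, ∃ z : ℤ, T * h28 a k = z) {F : Finset (Fin 28) → ℝ}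
    (hF : ∀ A, F A = ∑ m ∈ Finset.range ((bkpts a T).card - 1), ((patternN a (bkpt a T m) A : ℤ) : ℝ))
    {δ : Fin 8 → ℝ} (hd : DifferentiableAt ℝ (cuspSlope a T) δ) {δ₀ δ₀' : Fin 8 → ℝ}
    (hgen : ∀ k l : Fin 28, k ≠ l → phiForm δ₀ k / h28 a k ≠ phiForm δ₀ l / h28 a l)
    (hgen' : ∀ k l : Fin 28, k ≠ l → phiForm δ₀' k / h28 a k ≠ phiForm δ₀' l / h28 a l)
    (href : ∀ k l : Fin 28, phiForm δ k / h28 a k < phiForm δ l / h28 a l →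
      phiForm δ₀ k / h28 a k < phiForm δ₀ l / h28 a l)
    (href' : ∀ k l : Fin 28, phiForm δ k / h28 a k < phiForm δ l / h28 a l →
      phiForm δ₀' k / h28 a k < phiForm δ₀' l / h28 a l)
    {k l : Fin 28} (hkl : k ≠ l) (hρ : phiForm δ₀ l / h28 a l < phiForm δ₀ k / h28 a k)
    (hρ' : phiForm δ₀' k / h28 a k < phiForm δ₀' l / h28 a l)
    (hadj : ∀ j : Fin 28, ¬(phiForm δ₀ l / h28 a l < phiForm δ₀ j / h28 a j ∧
      phiForm δ₀ j / h28 a j < phiForm δ₀ k / h28 a k))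
    (hside : ∀ j : Fin 28, j ≠ k → j ≠ l →
      (phiForm δ₀ k / h28 a k < phiForm δ₀ j / h28 a j ↔ phiForm δ₀' k / h28 a k < phiForm δ₀' j / h28 a j) ∧
        (phiForm δ₀ l / h28 a l < phiForm δ₀ j / h28 a j ↔ phiForm δ₀' l / h28 a l < phiForm δ₀' j / h28 a j))
    (hsame : ∀ i j : Fin 28, i ≠ k → i ≠ l → j ≠ k → j ≠ l →
      (phiForm δ₀ i / h28 a i < phiForm δ₀ j / h28 a j ↔ phiForm δ₀' i / h28 a i < phiForm δ₀' j / h28 a j)) :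
    F (insert k (Finset.univ.filter fun j => phiForm δ₀ k / h28 a k < phiForm δ₀ j / h28 a j)) +
        F (insert l (Finset.univ.filter fun j => phiForm δ₀ k / h28 a k < phiForm δ₀ j / h28 a j)) -
        F (Finset.univ.filter fun j => phiForm δ₀ k / h28 a k < phiForm δ₀ j / h28 a j) -
        F (insert k (insert l (Finset.univ.filter fun j => phiForm δ₀ k / h28 a k < phiForm δ₀ j / h28 a j))) = 0 := by
  -- a direction separating `k` from `l`
  obtain ⟨v, hv⟩ := exists_rate_sub_ne_zero hpos hkl
  -- g30: the two functionals differ by the defect times the splitting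
  have h := greedy_sub_greedy_of_adjacent (M := Finset.univ) F (ρ := fun j => phiForm δ₀ j / h28 a j)
    (ρ' := fun j => phiForm δ₀' j / h28 a j) (fun i _ j _ hij => hgen i j hij) (fun i _ j _ hij => hgen' i j hij)
    (Finset.mem_univ k) (Finset.mem_univ l) hkl hρ hρ' (fun j _ => hadj j) (fun j _ => hside j) (fun i _ j _ => hsame i j)
    (fun j => phiForm v j / h28 a j)
  beta_reduce at h
  -- file (1): both functionals are the derivative
  rw [greedy_eq_fderiv_of_differentiableAt hpos hT hper hF hd hgen' href' v,
    greedy_eq_fderiv_of_differentiableAt hpos hT hper hF hd hgen href v, sub_self] at h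
  rcases mul_eq_zero.mp h.symm with h0 | h0
  · exact h0
  · exact absurd (by linarith) hv

/-! ### THE EXTREMUM CRITERION -/

/-- **THE DIRECTIONS SERVED BY A REFERENCE FORM A CLOSED POLYHEDRAL CONE.** For a generic `δ₀`: `δ₀` refines the lexicographic
order of `(δ, Δ)` iff `δ₀` refines `δ` AND `Δ` lies in the LOCAL CONE of `δ₀` at `δ` — `r_k(Δ) ≤ r_l(Δ)` for every pair tied at `δ`
with `r_k(δ₀) < r_l(δ₀)` (the tangent cone at `δ` of the closed chamber of `δ₀`). So the criteria below are FINITE: one polyhedral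
cone and one linear functional per generic order realised near `δ`. -/
theorem refines_lex_iff_cone {a : Dir} {δ Δ δ₀ : Fin 8 → ℝ}
    (hgen : ∀ k l : Fin 28, k ≠ l → phiForm δ₀ k / h28 a k ≠ phiForm δ₀ l / h28 a l) :
    (∀ k l : Fin 28, (phiForm δ k / h28 a k < phiForm δ l / h28 a l ∨
        (phiForm δ k / h28 a k = phiForm δ l / h28 a l ∧ phiForm Δ k / h28 a k < phiForm Δ l / h28 a l)) →
      phiForm δ₀ k / h28 a k < phiForm δ₀ l / h28 a l) ↔
      (∀ k l : Fin 28, phiForm δ k / h28 a k < phiForm δ l / h28 a l →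
          phiForm δ₀ k / h28 a k < phiForm δ₀ l / h28 a l) ∧
        ∀ k l : Fin 28, phiForm δ k / h28 a k = phiForm δ l / h28 a l →
          phiForm δ₀ k / h28 a k < phiForm δ₀ l / h28 a l → phiForm Δ k / h28 a k ≤ phiForm Δ l / h28 a l := by
  constructor
  · intro hlex
    refine ⟨fun k l h => hlex k l (Or.inl h), fun k l he h0 => ?_⟩
    by_contra hlt
    exact lt_asymm h0 (hlex l k (Or.inr ⟨he.symm, not_le.mp hlt⟩))
  · rintro ⟨href, hcone⟩ k l h
    rcases h with h | ⟨he, hs⟩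
    · exact href k l h
    · rcases lt_trichotomy (phiForm δ₀ k / h28 a k) (phiForm δ₀ l / h28 a l) with h1 | h1 | h1
      · exact h1
      · by_cases hkl : k = l
        · subst hkl; exact absurd hs (lt_irrefl _)
        · exact absurd h1 (hgen k l hkl)
      · exact absurd hs (not_lt.mpr (hcone l k he.symm h1))

/-- **THE LOCAL-MAXIMUM CRITERION.** All 28 forms of `a` positive, `T > 0` a period, `F` the canonical period pattern function.
Then **`δ` is a local maximiser of `σ` iff every one-sided directional derivative of `σ` at `δ` is `≤ 0`**, i.e. iff for every
direction `Δ` and every generic reference `δ₀` refining the lexicographic order of `(δ, Δ)`, `Σ_k W_k(δ₀)·φ_k(Δ)/h_k(a) ≤ 0`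
(⇐ because the tangent cone is attained on a neighbourhood, file (1); for a general function this direction fails). By
`refines_lex_iff_cone` this reads: every generic reference refining `δ` has its functional `≤ 0` on its local cone at `δ`. -/
theorem isLocalMax_cuspSlope_iff {a : Dir} (hpos : ∀ k, 0 < h28 a k) {T : ℝ} (hT : 0 < T)
    (hper : ∀ k : Fin 28, ∃ z : ℤ, T * h28 a k = z) {F : Finset (Fin 28) → ℝ}
    (hF : ∀ A, F A = ∑ m ∈ Finset.range ((bkpts a T).card - 1), ((patternN a (bkpt a T m) A : ℤ) : ℝ))
    (δ : Fin 8 → ℝ) :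
    IsLocalMax (cuspSlope a T) δ ↔
      ∀ Δ δ₀ : Fin 8 → ℝ, (∀ k l : Fin 28, k ≠ l → phiForm δ₀ k / h28 a k ≠ phiForm δ₀ l / h28 a l) →
        (∀ k l : Fin 28, (phiForm δ k / h28 a k < phiForm δ l / h28 a l ∨
            (phiForm δ k / h28 a k = phiForm δ l / h28 a l ∧ phiForm Δ k / h28 a k < phiForm Δ l / h28 a l)) →
          phiForm δ₀ k / h28 a k < phiForm δ₀ l / h28 a l) →
        ∑ k, (F (Finset.univ.filter fun l => phiForm δ₀ k / h28 a k ≤ phiForm δ₀ l / h28 a l) -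
            F (Finset.univ.filter fun l => phiForm δ₀ k / h28 a k < phiForm δ₀ l / h28 a l)) *
          (phiForm Δ k / h28 a k) ≤ 0 := by
  constructor
  · intro hmax Δ δ₀ hgen hlex
    obtain ⟨t₀, ht₀, hgerm⟩ := cuspSlope_add_smul_eq_of_lex hpos hT hper hF δ Δ hgen hlex
    -- pull the local maximum back along the segment `t ↦ δ + t·Δ`
    have hline : Tendsto (fun t : ℝ => δ + t • Δ) (𝓝[>] 0) (𝓝 δ) := by
      have hc : Continuous fun t : ℝ => δ + t • Δ := continuous_const.add (continuous_id.smul continuous_const)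
      have h0 := hc.tendsto 0
      rw [zero_smul, add_zero] at h0
      exact h0.mono_left nhdsWithin_le_nhds
    have hmax' : ∀ᶠ x in 𝓝 δ, cuspSlope a T x ≤ cuspSlope a T δ := hmax
    have hev : ∀ᶠ t in 𝓝[>] (0 : ℝ), t ∈ Ioc 0 t₀ := Ioc_mem_nhdsGT ht₀
    obtain ⟨t, ⟨ht, htle⟩, hle⟩ := (hev.and (hline.eventually hmax')).exists
    rw [hgerm t ⟨ht.le, htle⟩] at hle
    by_contra hpos'
    have : 0 < t * ∑ k, (F (Finset.univ.filter fun l => phiForm δ₀ k / h28 a k ≤ phiForm δ₀ l / h28 a l) -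
        F (Finset.univ.filter fun l => phiForm δ₀ k / h28 a k < phiForm δ₀ l / h28 a l)) *
      (phiForm Δ k / h28 a k) := mul_pos ht (not_le.mp hpos')
    linarith
  · intro h
    show ∀ᶠ δ' in 𝓝 δ, cuspSlope a T δ' ≤ cuspSlope a T δ
    filter_upwards [cuspSlope_eq_add_lex_functional_eventually hpos hT hper hF δ] with δ' hδ'
    obtain ⟨δ₀, hgen, hlex⟩ := exists_generic_refines_lex hpos δ (δ' - δ)
    rw [hδ' δ₀ hgen hlex]
    have hle := h (δ' - δ) δ₀ hgen hlex
    linarith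

/-- **THE LOCAL-MINIMUM CRITERION**: `δ` is a local minimiser of `σ` iff every one-sided directional derivative of `σ` at `δ`
is `≥ 0` (every lexicographic chamber functional of `(δ, Δ)` is `≥ 0` at `Δ`). -/
theorem isLocalMin_cuspSlope_iff {a : Dir} (hpos : ∀ k, 0 < h28 a k) {T : ℝ} (hT : 0 < T)
    (hper : ∀ k : Fin 28, ∃ z : ℤ, T * h28 a k = z) {F : Finset (Fin 28) → ℝ}
    (hF : ∀ A, F A = ∑ m ∈ Finset.range ((bkpts a T).card - 1), ((patternN a (bkpt a T m) A : ℤ) : ℝ))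
    (δ : Fin 8 → ℝ) :
    IsLocalMin (cuspSlope a T) δ ↔
      ∀ Δ δ₀ : Fin 8 → ℝ, (∀ k l : Fin 28, k ≠ l → phiForm δ₀ k / h28 a k ≠ phiForm δ₀ l / h28 a l) →
        (∀ k l : Fin 28, (phiForm δ k / h28 a k < phiForm δ l / h28 a l ∨
            (phiForm δ k / h28 a k = phiForm δ l / h28 a l ∧ phiForm Δ k / h28 a k < phiForm Δ l / h28 a l)) →
          phiForm δ₀ k / h28 a k < phiForm δ₀ l / h28 a l) →
        0 ≤ ∑ k, (F (Finset.univ.filter fun l => phiForm δ₀ k / h28 a k ≤ phiForm δ₀ l / h28 a l) -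
            F (Finset.univ.filter fun l => phiForm δ₀ k / h28 a k < phiForm δ₀ l / h28 a l)) *
          (phiForm Δ k / h28 a k) := by
  constructor
  · intro hmin Δ δ₀ hgen hlex
    obtain ⟨t₀, ht₀, hgerm⟩ := cuspSlope_add_smul_eq_of_lex hpos hT hper hF δ Δ hgen hlex
    have hline : Tendsto (fun t : ℝ => δ + t • Δ) (𝓝[>] 0) (𝓝 δ) := by
      have hc : Continuous fun t : ℝ => δ + t • Δ := continuous_const.add (continuous_id.smul continuous_const)
      have h0 := hc.tendsto 0
      rw [zero_smul, add_zero] at h0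
      exact h0.mono_left nhdsWithin_le_nhds
    have hmin' : ∀ᶠ x in 𝓝 δ, cuspSlope a T δ ≤ cuspSlope a T x := hmin
    have hev : ∀ᶠ t in 𝓝[>] (0 : ℝ), t ∈ Ioc 0 t₀ := Ioc_mem_nhdsGT ht₀
    obtain ⟨t, ⟨ht, htle⟩, hle⟩ := (hev.and (hline.eventually hmin')).exists
    rw [hgerm t ⟨ht.le, htle⟩] at hle
    by_contra hneg
    have : t * ∑ k, (F (Finset.univ.filter fun l => phiForm δ₀ k / h28 a k ≤ phiForm δ₀ l / h28 a l) -
        F (Finset.univ.filter fun l => phiForm δ₀ k / h28 a k < phiForm δ₀ l / h28 a l)) *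
      (phiForm Δ k / h28 a k) < 0 := mul_neg_of_pos_of_neg ht (not_le.mp hneg)
    linarith
  · intro h
    show ∀ᶠ δ' in 𝓝 δ, cuspSlope a T δ ≤ cuspSlope a T δ'
    filter_upwards [cuspSlope_eq_add_lex_functional_eventually hpos hT hper hF δ] with δ' hδ'
    obtain ⟨δ₀, hgen, hlex⟩ := exists_generic_refines_lex hpos δ (δ' - δ)
    rw [hδ' δ₀ hgen hlex]
    have hle := h (δ' - δ) δ₀ hgen hlex
    linarith

/-- **A LOCAL EXTREMUM OF `σ` AT A DIFFERENTIABILITY POINT IS FLAT**: if `σ` is differentiable at a local extremum `δ`, then `σ` is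
CONSTANT on a neighbourhood of `δ` (file (1): `σ` is affine there; the gradient of a local extremum vanishes) — every STRICT
local extremum of `σ` is a non-differentiability point, i.e. a point with two refining references of different functionals. -/
theorem cuspSlope_eventually_const_of_isLocalExtr {a : Dir} (hpos : ∀ k, 0 < h28 a k) {T : ℝ} (hT : 0 < T)
    (hper : ∀ k : Fin 28, ∃ z : ℤ, T * h28 a k = z) {F : Finset (Fin 28) → ℝ}
    (hF : ∀ A, F A = ∑ m ∈ Finset.range ((bkpts a T).card - 1), ((patternN a (bkpt a T m) A : ℤ) : ℝ))
    {δ : Fin 8 → ℝ} (hd : DifferentiableAt ℝ (cuspSlope a T) δ) (hext : IsLocalExtr (cuspSlope a T) δ) :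
    ∀ᶠ δ' in 𝓝 δ, cuspSlope a T δ' = cuspSlope a T δ := by
  filter_upwards [cuspSlope_eq_affine_near_of_differentiableAt hpos hT hper hF hd] with δ' h
  rw [h, hext.fderiv_eq_zero, zero_apply, add_zero]

/-- **AT THE ORIGIN: `0` IS A LOCAL MAXIMISER OF `σ` IFF THERE IS NO ASCENT DIRECTION** (`σ ≤ 0` everywhere): the lexicographic
references of `(0, Δ)` are the generic references refining `Δ`, whose functional at `Δ` is `σ(Δ)` (P2 g33's chamber formula). -/
theorem isLocalMax_cuspSlope_zero_iff {a : Dir} (hpos : ∀ k, 0 < h28 a k) {T : ℝ} (hT : 0 < T)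
    (hper : ∀ k : Fin 28, ∃ z : ℤ, T * h28 a k = z) :
    IsLocalMax (cuspSlope a T) 0 ↔ ∀ Δ : Fin 8 → ℝ, cuspSlope a T Δ ≤ 0 := by
  classical
  obtain ⟨F, hF⟩ : ∃ F : Finset (Fin 28) → ℝ,
      ∀ A, F A = ∑ m ∈ Finset.range ((bkpts a T).card - 1), ((patternN a (bkpt a T m) A : ℤ) : ℝ) := ⟨_, fun _ => rfl⟩
  have h0 : ∀ k, phiForm (0 : Fin 8 → ℝ) k / h28 a k = 0 := fun k => by rw [phiForm_zero, zero_div]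
  rw [isLocalMax_cuspSlope_iff hpos hT hper hF]
  constructor
  · intro h Δ
    obtain ⟨δ₀, hgen, href⟩ := exists_generic_refines hpos Δ
    rw [cuspSlope_eq_greedy_canonical_of_refines hpos hT hper hF hgen Δ href]
    exact h Δ δ₀ hgen fun k l hkl => hkl.elim (fun h' => absurd h' (by rw [h0, h0]; exact lt_irrefl _))
      fun h' => href k l h'.2
  · intro h Δ δ₀ hgen hlex
    rw [← cuspSlope_eq_greedy_canonical_of_refines hpos hT hper hF hgen Δ fun k l hkl =>
      hlex k l (Or.inr ⟨by rw [h0, h0], hkl⟩)]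
    exact h Δ

end Summit.KontsevichZagierPeriods.Zeta5Search.Barrier.ConeGamma

end
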